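import Summits.AtomisticToContinuum.Crystallization.Theorems.ChartedPlanarOrderDoorLayered

/-!
# «DoorLayered» — follow-up module «Exactness» (lens-3 g22 node v3, sha256 d7923588…, §3d + §4 mixed seams): EXACTNESS BY DISCRETENESS
# `twoPeriodic_of_forall_nearHomBD` (δ-separated `S` with `NearHomBD Λ τ Λ S S` for all `τ > 0` is `Λ`-two-periodic), hence
# `doorPeriodic_of_doorHomogeneityBD : DoorHomogeneityBD Λ → DoorPeriodic Λ` (L1′_BD ⟹ L1′♮ at the same `Λ`), `isLayered_of_doorHomogeneityBD`,
# and the mixed seams `gap_and_pert_1_50_of_homBD_periodic : DoorHomogeneityBD Λ → PeriodicBulkGapDoor Λ → VisibleGap (1/50) ∧ PertRegime (1/50)`,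
# `bulkDoor_of_homBD_periodic`.  These are exactly the declarations v3 adds to v2 (8d27d62f…, landed as …DoorLayeredExact / …DoorLayeredNear /
# …DoorLayered, p818730 / p818924 / p819018); same namespace, so every FQN is the node's.  Landed by hand-2 g8 on lens-3's INBOX offer
# 09:35:12Z (critic rows 407 (3) / 409 (1)).  No definitions, no `sorry`.
-/

noncomputable section

open MeasureTheory Set Metric
open Summit.AtomisticToContinuum.Crystallization.Theorems.ChartedPlanarOrderRigidityDoor
open Summit.AtomisticToContinuum.Crystallization.Theorems.ChartedPlanarOrderDensityDichotomy
open Summit.AtomisticToContinuum.Crystallization.Theorems.ChartedPlanarOrderMesoCut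
open Summit.AtomisticToContinuum.Crystallization.Theorems.OverbindingBudgetLiouvilleDictionary
  (NearHomBD not_nearHomBD_singleton nearHom_of_nearHomBD norm_triangularVec₁_one countable_of_isSep)
open Literature.MathematicalPhysics.StatisticalMechanics (triangularVec₁ triangularVec₂)

namespace Summit.AtomisticToContinuum.Crystallization.Theorems.ChartedPlanarOrderDoorLayered

/-! ### 3d. EXACTNESS BY DISCRETENESS: `NearHomBD` at every tolerance on a separated set forces two exact periods -/

open Filter Topology

/-- from ONE near-homogeneity instance (radius `≥ Λ`): approximate periods `a = L t₁`, `b = L t₂` of length `≤ Λ`, quantitatively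
independent (`‖s t₁ + t t₂‖ ≤ Λ‖s a + t b‖`), each of `±a, ±b` `τ`-matched at every atom of `S`. -/
theorem exists_near_periods_of_nearHomBD {Λ τ r : ℝ} (hΛr : Λ ≤ r) {S : Set E3} (h : NearHomBD Λ τ r S S) :
    ∃ a b : E3, ‖a‖ ≤ Λ ∧ ‖b‖ ≤ Λ ∧
      (∀ s t : ℝ, ‖s • triangularVec₁ 1 + t • triangularVec₂ 1‖ ≤ Λ * ‖s • a + t • b‖) ∧
      ∀ x ∈ S, (∃ p ∈ S, ‖p - x - a‖ ≤ τ) ∧ (∃ p ∈ S, ‖p - x + a‖ ≤ τ) ∧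
        (∃ p ∈ S, ‖p - x - b‖ ≤ τ) ∧ (∃ p ∈ S, ‖p - x + b‖ ≤ τ) := by
  obtain ⟨L, hL, hL', w, Ψ, -, hmaps, henv⟩ := h
  have hn := norm_map_triangularVec_le (L : E3 →L[ℝ] E3) hL
  refine ⟨(L : E3 →L[ℝ] E3) (triangularVec₁ 1), (L : E3 →L[ℝ] E3) (triangularVec₂ 1), hn.1, hn.2, fun s t => ?_,
    fun x hx => ?_⟩
  · have h1 := norm_le_norm_symm_mul L (s • triangularVec₁ 1 + t • triangularVec₂ 1)
    rw [map_add, map_smul, map_smul] at h1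
    exact h1.trans (mul_le_mul_of_nonneg_right hL' (norm_nonneg _))
  · have hy : Ψ x ∈ LayeredHom (L : E3 →L[ℝ] E3) w := hmaps hx
    have hyL : Ψ x ∈ Layered ((L : E3 →L[ℝ] E3) (triangularVec₁ 1)) ((L : E3 →L[ℝ] E3) (triangularVec₂ 1)) w := by
      rw [← layeredHom_eq_layered]; exact hy
    have hx' := henv x hx
    have hm₁ : Ψ x + (L : E3 →L[ℝ] E3) (-triangularVec₁ 1) ∈ LayeredHom (L : E3 →L[ℝ] E3) w := by
      rw [map_neg, layeredHom_eq_layered]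
      exact ((isPeriod_layered_fst _ _ w).neg (Ψ x)).2 hyL
    have hm₂ : Ψ x + (L : E3 →L[ℝ] E3) (-triangularVec₂ 1) ∈ LayeredHom (L : E3 →L[ℝ] E3) w := by
      rw [map_neg, layeredHom_eq_layered]
      exact ((isPeriod_layered_snd _ _ w).neg (Ψ x)).2 hyL
    refine ⟨?_, ?_, ?_, ?_⟩
    · exact exists_atom_near_gen hx' (layeredHom_add_gen₁ hy) (hn.1.trans hΛr)
    · obtain ⟨p, hp, hd⟩ := exists_atom_near_gen hx' hm₁ (by rw [map_neg, norm_neg]; exact hn.1.trans hΛr)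
      exact ⟨p, hp, by rwa [map_neg, sub_neg_eq_add] at hd⟩
    · exact exists_atom_near_gen hx' (layeredHom_add_gen₂ hy) (hn.2.trans hΛr)
    · obtain ⟨p, hp, hd⟩ := exists_atom_near_gen hx' hm₂ (by rw [map_neg, norm_neg]; exact hn.2.trans hΛr)
      exact ⟨p, hp, by rwa [map_neg, sub_neg_eq_add] at hd⟩

/-- **discreteness**: in a separated configuration, approximate translates `x + uₙ` (precision `εₙ → 0`, `uₙ → v`) are eventually ONE
atom, which is `x + v`. -/
theorem add_mem_of_near_translates {δ : ℝ} (hδ : 0 < δ) {S : Set E3} (hS : IsSep δ S) {x v : E3} {u : ℕ → E3} {ε : ℕ → ℝ}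
    (hu : Tendsto u atTop (𝓝 v)) (hε : Tendsto ε atTop (𝓝 0)) (h : ∀ n, ∃ p ∈ S, ‖p - x - u n‖ ≤ ε n) :
    x + v ∈ S := by
  choose p hpS hp using h
  have hconv : Tendsto p atTop (𝓝 (x + v)) := by
    rw [tendsto_iff_norm_sub_tendsto_zero]
    have h0 : Tendsto (fun n => ε n + ‖u n - v‖) atTop (𝓝 0) := by
      have h1 := hε.add (tendsto_iff_norm_sub_tendsto_zero.1 hu)
      rw [add_zero] at h1
      exact h1
    refine squeeze_zero (fun n => norm_nonneg _) (fun n => ?_) h0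
    calc ‖p n - (x + v)‖ = ‖(p n - x - u n) + (u n - v)‖ := by congr 1; abel
      _ ≤ ‖p n - x - u n‖ + ‖u n - v‖ := norm_add_le _ _
      _ ≤ ε n + ‖u n - v‖ := by linarith [hp n]
  obtain ⟨N, hN⟩ := Filter.eventually_atTop.1 ((Metric.tendsto_nhds.1 hconv) (δ / 2) (half_pos hδ))
  have hconst : ∀ n ≥ N, p n = p N := fun n hn => by
    by_contra hne
    have h1 := hS (p n) (hpS n) (p N) (hpS N) hne
    have h2 : dist (p n) (p N) < δ :=
      calc dist (p n) (p N) ≤ dist (p n) (x + v) + dist (p N) (x + v) := dist_triangle_right _ _ _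
        _ < δ / 2 + δ / 2 := add_lt_add (hN n hn) (hN N le_rfl)
        _ = δ := by ring
    exact absurd h1 (not_le.2 h2)
  have hlim : Tendsto (fun _ : ℕ => p N) atTop (𝓝 (x + v)) :=
    hconv.congr' (Filter.eventually_atTop.2 ⟨N, fun n hn => hconst n hn⟩)
  rw [tendsto_nhds_unique hlim tendsto_const_nhds]
  exact hpS N

/-- **EXACTNESS BY DISCRETENESS**: a `δ`-separated configuration that is `(Λ; τ, Λ)`-near-homogeneous (currency of record) at EVERY
precision `τ > 0` has two linearly independent exact periods of length `≤ Λ`. -/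
theorem twoPeriodic_of_forall_nearHomBD {Λ δ : ℝ} (hδ : 0 < δ) {S : Set E3} (hS : IsSep δ S)
    (h : ∀ τ : ℝ, 0 < τ → NearHomBD Λ τ Λ S S) : TwoPeriodic Λ S := by
  have hstep : ∀ n : ℕ, ∃ ab : E3 × E3, (‖ab.1‖ ≤ Λ ∧ ‖ab.2‖ ≤ Λ) ∧
      (∀ s t : ℝ, ‖s • triangularVec₁ 1 + t • triangularVec₂ 1‖ ≤ Λ * ‖s • ab.1 + t • ab.2‖) ∧
      ∀ x ∈ S, (∃ p ∈ S, ‖p - x - ab.1‖ ≤ 1 / ((n : ℝ) + 1)) ∧ (∃ p ∈ S, ‖p - x + ab.1‖ ≤ 1 / ((n : ℝ) + 1)) ∧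
        (∃ p ∈ S, ‖p - x - ab.2‖ ≤ 1 / ((n : ℝ) + 1)) ∧ (∃ p ∈ S, ‖p - x + ab.2‖ ≤ 1 / ((n : ℝ) + 1)) := fun n => by
    obtain ⟨a, b, ha, hb, hq, hP⟩ := exists_near_periods_of_nearHomBD le_rfl (h _ Nat.one_div_pos_of_nat)
    exact ⟨(a, b), ⟨ha, hb⟩, hq, hP⟩
  choose ab hnorm hquant hper using hstep
  have hK : IsCompact (Metric.closedBall (0 : E3) Λ ×ˢ Metric.closedBall (0 : E3) Λ) :=
    (isCompact_closedBall 0 Λ).prod (isCompact_closedBall 0 Λ)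
  have hmem : ∀ n, ab n ∈ Metric.closedBall (0 : E3) Λ ×ˢ Metric.closedBall (0 : E3) Λ := fun n =>
    ⟨mem_closedBall_zero_iff.2 (hnorm n).1, mem_closedBall_zero_iff.2 (hnorm n).2⟩
  obtain ⟨⟨a, b⟩, hab, φ, hφ, hlim⟩ := hK.tendsto_subseq hmem
  have ha : Tendsto (fun n => (ab (φ n)).1) atTop (𝓝 a) := (continuous_fst.tendsto _).comp hlim
  have hb : Tendsto (fun n => (ab (φ n)).2) atTop (𝓝 b) := (continuous_snd.tendsto _).comp hlim
  have hε : Tendsto (fun n => 1 / ((φ n : ℝ) + 1)) atTop (𝓝 0) :=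
    tendsto_one_div_add_atTop_nhds_zero_nat.comp hφ.tendsto_atTop
  have hpa : ∀ x ∈ S, x + a ∈ S := fun x hx =>
    add_mem_of_near_translates hδ hS ha hε (fun n => (hper (φ n) x hx).1)
  have hna : ∀ x ∈ S, x + -a ∈ S := fun x hx =>
    add_mem_of_near_translates hδ hS ha.neg hε (fun n => by simpa only [sub_neg_eq_add] using (hper (φ n) x hx).2.1)
  have hpb : ∀ x ∈ S, x + b ∈ S := fun x hx =>
    add_mem_of_near_translates hδ hS hb hε (fun n => (hper (φ n) x hx).2.2.1)
  have hnb : ∀ x ∈ S, x + -b ∈ S := fun x hx =>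
    add_mem_of_near_translates hδ hS hb.neg hε (fun n => by simpa only [sub_neg_eq_add] using (hper (φ n) x hx).2.2.2)
  have hq : ∀ s t : ℝ, ‖s • triangularVec₁ 1 + t • triangularVec₂ 1‖ ≤ Λ * ‖s • a + t • b‖ := fun s t => by
    have hc : Tendsto (fun n => Λ * ‖s • (ab (φ n)).1 + t • (ab (φ n)).2‖) atTop (𝓝 (Λ * ‖s • a + t • b‖)) :=
      ((ha.const_smul s).add (hb.const_smul t)).norm.const_mul Λ
    exact ge_of_tendsto' hc (fun n => hquant (φ n) s t)
  refine ⟨a, b, ?_, mem_closedBall_zero_iff.1 hab.1, mem_closedBall_zero_iff.1 hab.2,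
    fun p => ⟨fun hp => ?_, fun hp => hpa p hp⟩, fun p => ⟨fun hp => ?_, fun hp => hpb p hp⟩⟩
  · rw [LinearIndependent.pair_iff]
    intro s t hst
    have h0 : ‖s • triangularVec₁ 1 + t • triangularVec₂ 1‖ ≤ 0 := by
      have h1 := hq s t
      rw [hst, norm_zero, mul_zero] at h1
      exact h1
    exact LinearIndependent.pair_iff.1 linearIndependent_triangularVec s t (norm_le_zero_iff.1 h0)
  · have h1 := hna (p + a) hp
    rwa [add_neg_cancel_right] at h1
  · have h1 := hnb (p + b) hp
    rwa [add_neg_cancel_right] at h1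

/-- ★ **L1′_BD ⟹ L1′♮ (PROVED)**: near-homogeneity of every door configuration at every precision (currency of record) gives EXACT
two-periodicity with periods of length `≤ Λ` — the exact branch is implied by the branch of record on the Liouville side. -/
theorem doorPeriodic_of_doorHomogeneityBD {Λ : ℝ} (h : DoorHomogeneityBD Λ) : DoorPeriodic Λ := by
  intro δ hδ S hS
  obtain ⟨L, hL, -⟩ := h δ hδ 1 one_pos 1 one_pos S hS
  have hΛ : 0 < Λ := (ContinuousLinearEquiv.norm_pos L).trans_le hL
  exact twoPeriodic_of_forall_nearHomBD hδ hS.2.1 (fun τ hτ => h δ hδ τ hτ Λ hΛ S hS)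

/-- hence every door configuration IS layered under L1′_BD (model-side reading through the EQUIV). -/
theorem isLayered_of_doorHomogeneityBD {Λ : ℝ} (h : DoorHomogeneityBD Λ) {δ : ℝ} (hδ : 0 < δ) {S : Set E3} (hS : IsDoorSet δ S) :
    IsLayered Λ S :=
  isLayered_of_doorPeriodic (doorPeriodic_of_doorHomogeneityBD h) hδ hS

/-- ★★ the MIXED seam (via exactness by discreteness, §3d): L1′_BD (of record) ∧ HBG″ (chart-free, WEAKER than BULK|door) already give N's
registered conclusions — no chart-carrying energy piece is needed on either branch. -/
theorem gap_and_pert_1_50_of_homBD_periodic {Λ : ℝ} (h1 : DoorHomogeneityBD Λ) (hG : PeriodicBulkGapDoor Λ) :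
    VisibleGap (1 / 50) ∧ PertRegime (1 / 50) :=
  gap_and_pert_1_50_of_periodic (doorPeriodic_of_doorHomogeneityBD h1) hG

/-- … and BULK|door itself from L1′_BD ∧ HBG″. -/
theorem bulkDoor_of_homBD_periodic {Λ : ℝ} (h1 : DoorHomogeneityBD Λ) (hG : PeriodicBulkGapDoor Λ) : BulkDefectGapDoor :=
  bulkDoor_of_periodic (doorPeriodic_of_doorHomogeneityBD h1) hG

end Summit.AtomisticToContinuum.Crystallization.Theorems.ChartedPlanarOrderDoorLayered

end
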